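import Literature.MathematicalPhysics.QuantumFieldTheory.Balaban1983to89.B12Spaces329NearStep
import Literature.MathematicalPhysics.QuantumFieldTheory.Balaban1983to89.B13Space134
import Literature.MathematicalPhysics.QuantumFieldTheory.Balaban1983to89.B13Inv214OrbitSUN

/-!
# `Balaban1983to89.B12RegularSpaces111SpecialUnitary` — T. Bałaban, *Renormalization group approach to lattice gauge field theories. I*,
Commun. Math. Phys. **109** (1987) 249–301 [Balaban1987RG1], pp. 251–252: the VALUE DATA `B12RegularSpaces111.Model = ⟨G, Gᶜ, 𝔤ᶜ⟩`
INSTANTIATED at print's semisimple example `G = SU(N) ⊂ U(N)`: `G = SU(N)`, `Gᶜ = SL(N, ℂ)`, `𝔤ᶜ = 𝔰𝔩(N, ℂ)` (traceless matrices),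
`𝔸 = M_N(ℂ)` with the operator norm — and ALL the standing model hypotheses of the concrete-spaces lineage DISCHARGED for it
(`‖·‖ ≤ 1` on `G`; `G ≤ Gᶜ`; `𝔤ᶜ` `Ad(GL)`-stable; `exp iξE ∈ SL` for traceless `E`; and — the one with content — `𝔤ᶜ` CLOSED UNDER THE
BCH COMPOSITION `newPot ξ` in its range `ξ(‖X‖ + ‖Y‖) ≤ 1/4`, `ξ ≥ 0`, by Liouville's formula `det e^Z = e^{tr Z}` and a continuity
argument), whence the `G`-invariance of (i)–(iii)/(3.16)/(1.34) and the near-`G` clause of (3.29) HYPOTHESIS-FREE for `SU(N)` (PROVED)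

HONEST FRAMING (cell `lit-balaban`, verbatim): statement-level skeleton of published theorems with citation tags; proofs where landed; nothing here is a claim about the Yang–Mills mass gap.

PDF held: `paper:balaban1987-cmp109-rg-i-small-field` (journal page = PDF page + 248); pp. 251–252, 262, 276 read from the text layer.

WHAT IS REPRODUCED.  Nothing of the paper is asserted; this is the MODEL INSTANCE (referee protocol G.1) of the lineage's abstract value
data for print's own setting.  p. 251–252: *«Field configurations have values in a compact Lie group G. … We assume that G is semisimple
and that it is a Lie subgroup of a group of complex unitary matrices, for example G ⊂ U(N). … we also consider the complexified group Gᶜ.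
Elements of this group are defined as matrices of the form 𝐔 = U′U, where U ∈ G and U′ = exp iA′, A′ ∈ 𝔤ᶜ, 𝔤ᶜ is the complexification
of the real Lie algebra 𝔤.»*  For `G = SU(N)`: `𝔤 = 𝔰𝔲(N)`, `𝔤ᶜ = 𝔰𝔩(N, ℂ) = {X ∈ M_N(ℂ) : tr X = 0}`, `Gᶜ = SL(N, ℂ)` (pub-balaban's
`B13Inv214OrbitSUN.slUnits`, REUSED).  §1 the model `suModel N := ⟨SU(N), SL(N, ℂ), 𝔰𝔩(N, ℂ)⟩` (sub-objects of the units / of the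
algebra `M_N(ℂ)`); §2 the trace of the BCH composition: for traceless `X, Y` with `‖X‖ + ‖Y‖ ≤ 1/4`, `tr log(e^X e^Y) = 0`
(`trace_bchLog_eq_zero`) — along `t ↦ (tX, tY)`, `t ∈ [0, 1]`, `exp(tr log(e^{tX}e^{tY})) = det(e^{tX}e^{tY}) = e^{t·tr X}e^{t·tr Y} = 1`
(`exp_bchLog`, `det_exp`), so the continuous function `t ↦ tr log(e^{tX}e^{tY})` takes values in `2πiℤ` and vanishes at `t = 0`, hence at
`t = 1` (intermediate value theorem applied to its norm); consequently `tr newPot ξ X Y = 0` (`trace_newPot_eq_zero`, `ξ ≥ 0`,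
`ξ(‖X‖ + ‖Y‖) ≤ 1/4`); §3 the six model hypotheses; §4 the hypothesis-free corollaries for `SU(N)`-valued gauge transformations:
`satisfiesI_III_act_iff_su`, `act_mem_space316_iff_su` ([I] (3.29) for `G`-valued `u`), `satisfiesI_III_act_near_su`,
`exists_neighbourhood_su` (the near-`G` clause, sharp constants, via `B12Spaces329NearStep` — the step-`ξ` closure form, which is
the one `𝔰𝔩(N, ℂ)` satisfies; the `∀ξ` form of `B12Spaces329Near(Sharp)` is not satisfiable for `N ≥ 7`, see that file's header),
`act329_mem_space134_iff_su` ([II] (1.34)).  Norms: the `L²`-operator norm on `M_N(ℂ)` through the lineage's local instance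
`B10Eq29TubeLine.cstarAlgebraMatrix` (as in `B13Inv214OrbitSUN`).  No `Prop` placeholder, no new fact; three definitions with bodies
(`suUnits`, `slAlg`, `suModel`); axioms standard.  Unit `lit-balaban-p07` (Phase-2 seat p07 gen 5; TAKING line HOME/STATUS.md
2026-08-21T06:52:00Z), HOME `run/shared/lean/pub/lit-balaban/`.
-/

namespace Literature.MathematicalPhysics.QuantumFieldTheory.Balaban1983to89.B12RegularSpaces111SpecialUnitary

open NormedSpace
open Literature.Analysis.Complex (logOnePlus logOnePlus_zero continuousOn_logOnePlus_comp)
open Literature.MathematicalPhysics.QuantumFieldTheory.Balaban1983to89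
open Literature.MathematicalPhysics.QuantumFieldTheory.Balaban1983to89.B12RegularSpaces111
open Literature.MathematicalPhysics.QuantumFieldTheory.Balaban1983to89.B12RegularSpaces111Gauge
open Literature.MathematicalPhysics.QuantumFieldTheory.Balaban1983to89.B12Membership313II
open Literature.MathematicalPhysics.QuantumFieldTheory.Balaban1983to89.B12Spaces329NearStep
open Literature.MathematicalPhysics.QuantumFieldTheory.Balaban1983to89.B13Space134
open Literature.MathematicalPhysics.QuantumFieldTheory.Balaban1983to89.B13Inv214OrbitSUN (slUnits mem_slUnits_iff det_exp)
open Complex (I)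

noncomputable section

/-- `M_N(ℂ)`. -/
local notation "M[" N "]" => Matrix (Fin N) (Fin N) ℂ

attribute [local instance] B10Eq29TubeLine.cstarAlgebraMatrix

variable {N : ℕ}

/-! ## §1. `SU(N)`, `SL(N, ℂ)`, `𝔰𝔩(N, ℂ)` as sub-objects of `M_N(ℂ)ˣ` / `M_N(ℂ)`; the `SU(N)` model -/

variable (N) in
/-- `SU(N)` (Mathlib's `Matrix.specialUnitaryGroup`: unitary, `det = 1`) as a subgroup of the units `GL(N, ℂ) = M_N(ℂ)ˣ` — print's `G`
(«G is semisimple … a Lie subgroup of a group of complex unitary matrices»). [cite: Balaban1987RG1, pp.251–252] -/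
def suUnits : Subgroup (M[N])ˣ where
  carrier := {u | (u : M[N]) ∈ Matrix.specialUnitaryGroup (Fin N) ℂ}
  mul_mem' {u v} hu hv := by
    simp only [Set.mem_setOf_eq, Units.val_mul] at hu hv ⊢
    exact Submonoid.mul_mem _ hu hv
  one_mem' := by
    simp only [Set.mem_setOf_eq, Units.val_one]
    exact Submonoid.one_mem _
  inv_mem' {u} hu := by
    simp only [Set.mem_setOf_eq, Matrix.mem_specialUnitaryGroup_iff] at hu ⊢
    have e : ((u⁻¹ : (M[N])ˣ) : M[N]) = star (u : M[N]) :=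
      Units.inv_eq_of_mul_eq_one_right (Unitary.mul_star_self_of_mem hu.1)
    rw [e]
    refine ⟨Unitary.star_mem hu.1, ?_⟩
    rw [Matrix.star_eq_conjTranspose, Matrix.det_conjTranspose, hu.2, star_one]

/-- Membership in `suUnits N`. [cite: Balaban1987RG1, pp.251–252] -/
@[simp] theorem mem_suUnits_iff {u : (M[N])ˣ} : u ∈ suUnits N ↔ (u : M[N]) ∈ Matrix.specialUnitaryGroup (Fin N) ℂ :=
  Iff.rfl

variable (N) in
/-- `𝔰𝔩(N, ℂ) = {X ∈ M_N(ℂ) : tr X = 0}`, the complexification `𝔤ᶜ` of `𝔤 = 𝔰𝔲(N)`, as a `ℂ`-submodule of `M_N(ℂ)` (the kernel of the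
trace). [cite: Balaban1987RG1, p.252] -/
def slAlg : Submodule ℂ M[N] :=
  LinearMap.ker (Matrix.traceLinearMap (Fin N) ℂ ℂ)

/-- Membership in `slAlg N` is `tr X = 0`. [cite: Balaban1987RG1, p.252] -/
@[simp] theorem mem_slAlg_iff {X : M[N]} : X ∈ slAlg N ↔ X.trace = 0 :=
  LinearMap.mem_ker

variable (N) in
/-- **The `SU(N)` model of the value data**: `G = SU(N)`, `Gᶜ = SL(N, ℂ)` (`B13Inv214OrbitSUN.slUnits`), `𝔤ᶜ = 𝔰𝔩(N, ℂ)`.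
[cite: Balaban1987RG1, pp.251–252] -/
def suModel : Model M[N] where
  G := suUnits N
  Gc := slUnits N
  gc := slAlg N

/-- `G` of the model is `SU(N)`. [cite: Balaban1987RG1, pp.251–252] -/
@[simp] theorem mem_suModel_G {u : (M[N])ˣ} : u ∈ (suModel N).G ↔ (u : M[N]) ∈ Matrix.specialUnitaryGroup (Fin N) ℂ :=
  Iff.rfl

/-- Non-vacuity: every `U ∈ SU(N)` is a unit (`U⁻¹ = U⋆`, `Unitary.toUnits`) lying in `G`. [cite: Balaban1987RG1, pp.251–252] -/
theorem toUnits_mem_G (U : Matrix.specialUnitaryGroup (Fin N) ℂ) :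
    Unitary.toUnits ⟨U.1, Matrix.specialUnitaryGroup_le_unitaryGroup U.2⟩ ∈ (suModel N).G :=
  U.2

/-- `Gᶜ` of the model is `SL(N, ℂ)`: `det = 1`. [cite: Balaban1987RG1, p.252] -/
@[simp] theorem mem_suModel_Gc {u : (M[N])ˣ} : u ∈ (suModel N).Gc ↔ Matrix.det (u : M[N]) = 1 :=
  Iff.rfl

/-- `𝔤ᶜ` of the model is `𝔰𝔩(N, ℂ)`: `tr = 0`. [cite: Balaban1987RG1, p.252] -/
@[simp] theorem mem_suModel_gc {X : M[N]} : X ∈ (suModel N).gc ↔ X.trace = 0 :=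
  mem_slAlg_iff

/-! ## §2. The trace of the BCH composition of traceless matrices vanishes -/

/-- `tr(gXg⁻¹) = tr X` for invertible `g` (helper). [folklore] -/
private theorem trace_units_conj (g : (M[N])ˣ) (X : M[N]) : ((g : M[N]) * X * ((g⁻¹ : (M[N])ˣ) : M[N])).trace = X.trace := by
  rw [Matrix.trace_mul_cycle, Units.inv_mul, one_mul]

/-- **`tr log(e^X e^Y) = 0` for traceless `X, Y` with `‖X‖ + ‖Y‖ ≤ 1/4`** (`bchLog X Y = log(e^X e^Y)` by its series,
`B12Membership313II`).  Along `t ↦ (tX, tY)`, `t ∈ [0,1]`: `exp(tr log(e^{tX}e^{tY})) = det(e^{tX}e^{tY}) = e^{t tr X}·e^{t tr Y} = 1`, so the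
continuous `t ↦ tr log(e^{tX}e^{tY})` is `2πiℤ`-valued and `0` at `t = 0`; by the intermediate value theorem for its norm it never reaches
norm `π`, hence stays `0`.  This is the matrix fact behind print's «𝐔 = U′U, where U ∈ G and U′ = exp iA′, A′ ∈ 𝔤ᶜ» being a GROUP
(`Gᶜ = SL(N, ℂ)` closed under products, its logarithmic coordinates staying in `𝔤ᶜ = 𝔰𝔩(N, ℂ)`; print refers to [71] = Varadarajan for
Lie groups). [cite: Balaban1987RG1, p.252] -/
theorem trace_bchLog_eq_zero {X Y : M[N]} (h : ‖X‖ + ‖Y‖ ≤ 1 / 4) (hX : X.trace = 0) (hY : Y.trace = 0) :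
    (bchLog X Y).trace = 0 := by
  -- the path and the function
  set w : ℝ → M[N] := fun t => exp ((t : ℂ) • X) * exp ((t : ℂ) • Y) - 1 with hw
  set f : ℝ → ℂ := fun t => (logOnePlus (w t)).trace with hf
  have hsm : ∀ t ∈ Set.Icc (0 : ℝ) 1, ‖(t : ℂ) • X‖ + ‖(t : ℂ) • Y‖ ≤ 1 / 4 := fun t ht => by
    rw [norm_smul, norm_smul, Complex.norm_real, Real.norm_of_nonneg ht.1, ← mul_add]
    calc t * (‖X‖ + ‖Y‖) ≤ 1 * (‖X‖ + ‖Y‖) := mul_le_mul_of_nonneg_right ht.2 (by positivity)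
      _ ≤ 1 / 4 := by rw [one_mul]; exact h
  have hw1 : ∀ t ∈ Set.Icc (0 : ℝ) 1, ‖w t‖ < 1 := fun t ht => norm_expMul_sub_one_lt_one (hsm t ht)
  -- (a) `exp (f t) = det(e^{tX} e^{tY}) = 1`, so `f t ∈ 2πiℤ`
  have hval : ∀ t ∈ Set.Icc (0 : ℝ) 1, ∃ n : ℤ, f t = n * (2 * Real.pi * I) := fun t ht => by
    apply Complex.exp_eq_one_iff.1
    have e1 : Complex.exp (f t) = (exp (logOnePlus (w t))).det := (det_exp _).symm
    have e2 : exp (logOnePlus (w t)) = exp ((t : ℂ) • X) * exp ((t : ℂ) • Y) := exp_bchLog (hw1 t ht)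
    rw [e1, e2, Matrix.det_mul, det_exp, det_exp, Matrix.trace_smul, Matrix.trace_smul, hX, hY, smul_zero,
      Complex.exp_zero, mul_one]
  -- (b) `f` is continuous on `[0, 1]`
  have hcont : ContinuousOn f (Set.Icc 0 1) := by
    have hexpc : Continuous (exp : M[N] → M[N]) :=
      continuous_iff_continuousAt.2 fun x => (NormedSpace.exp_analytic (𝕂 := ℂ) x).continuousAt
    have hwc : Continuous w :=
      ((hexpc.comp (Complex.continuous_ofReal.smul continuous_const)).mul
        (hexpc.comp (Complex.continuous_ofReal.smul continuous_const))).sub continuous_const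
    have hlog : ContinuousOn (fun t => logOnePlus (w t)) (Set.Icc 0 1) :=
      continuousOn_logOnePlus_comp hwc.continuousOn hw1
    have htr : Continuous (Matrix.traceLinearMap (Fin N) ℂ ℂ : M[N] →ₗ[ℂ] ℂ) :=
      LinearMap.continuous_of_finiteDimensional _
    exact (htr.comp_continuousOn hlog).congr fun t _ => by
      rw [hf]; simp only [Function.comp_apply, Matrix.traceLinearMap_apply]
  -- (c) `f 0 = 0`
  have hf0 : f 0 = 0 := by
    simp only [hf, hw, Complex.ofReal_zero, zero_smul, exp_zero, mul_one, sub_self, logOnePlus_zero, Matrix.trace_zero]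
  -- (d) norms: `‖f t‖ ∈ 2π·ℕ`
  have h2π : ‖(2 * (Real.pi : ℂ) * I)‖ = 2 * Real.pi := by
    rw [norm_mul, norm_mul, Complex.norm_I, mul_one, Complex.norm_real, Real.norm_of_nonneg Real.pi_pos.le,
      Complex.norm_two]
  have hnorm : ∀ t ∈ Set.Icc (0 : ℝ) 1, ∃ m : ℤ, ‖f t‖ = 2 * Real.pi * |(m : ℝ)| := fun t ht => by
    obtain ⟨m, hm⟩ := hval t ht
    exact ⟨m, by rw [hm, norm_mul, Complex.norm_intCast, h2π, mul_comm]⟩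
  -- (e) `f 1 = 0`: otherwise `‖f 1‖ ≥ 2π`, and `‖f‖` would take the value `π` on `[0, 1]`
  have hf1 : f 1 = 0 := by
    by_contra hne
    obtain ⟨n, hn⟩ := hnorm 1 ⟨zero_le_one, le_rfl⟩
    have hn0 : (1 : ℝ) ≤ |(n : ℝ)| := by
      have h0 : n ≠ 0 := by
        rintro rfl
        apply hne
        have : ‖f 1‖ = 0 := by rw [hn]; simp
        exact norm_eq_zero.1 this
      exact_mod_cast Int.one_le_abs h0
    have hg : ContinuousOn (fun t => ‖f t‖) (Set.Icc 0 1) := hcont.norm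
    have hπ : Real.pi ∈ Set.Icc ‖f 0‖ ‖f 1‖ := by
      rw [hf0, norm_zero, hn]
      exact ⟨Real.pi_pos.le, by nlinarith [Real.pi_pos]⟩
    obtain ⟨t, ht, hgt⟩ := intermediate_value_Icc zero_le_one hg hπ
    obtain ⟨m, hm⟩ := hnorm t ht
    have h2m : (2 : ℝ) * |(m : ℝ)| = 1 := by
      have e : 2 * Real.pi * |(m : ℝ)| = Real.pi := hm.symm.trans hgt
      nlinarith [Real.pi_pos]
    have h2m' : ((2 * |m| : ℤ) : ℝ) = 1 := by push_cast; exact h2m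
    have h2m'' : (2 * |m| : ℤ) = 1 := by exact_mod_cast h2m'
    omega
  -- `bchLog X Y = logOnePlus (w 1)`
  have e : (bchLog X Y).trace = f 1 := by
    simp only [hf, hw, bchLog, Complex.ofReal_one, one_smul]
  rw [e, hf1]

/-- **`tr newPot ξ X Y = 0`** for traceless `X, Y`, `ξ ≥ 0`, `ξ(‖X‖ + ‖Y‖) ≤ 1/4`: `𝔰𝔩(N, ℂ)` is closed under the BCH composition
`newPot ξ X Y = (iξ)⁻¹ log(e^{iξX} e^{iξY})` of (1.13) in its range. [cite: Balaban1987RG1, (1.13) p.262] -/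
theorem trace_newPot_eq_zero {ξ : ℝ} (hξ : 0 ≤ ξ) {X Y : M[N]} (h : ξ * (‖X‖ + ‖Y‖) ≤ 1 / 4) (hX : X.trace = 0)
    (hY : Y.trace = 0) : (newPot ξ X Y).trace = 0 := by
  have hn : ‖(I * ξ) • X‖ + ‖(I * ξ) • Y‖ ≤ 1 / 4 := by
    rw [norm_smul, norm_smul, norm_mul, Complex.norm_I, one_mul, Complex.norm_real, Real.norm_of_nonneg hξ, ← mul_add]
    exact h
  simp only [newPot, Matrix.trace_smul]
  rw [trace_bchLog_eq_zero hn (by rw [Matrix.trace_smul, hX, smul_zero]) (by rw [Matrix.trace_smul, hY, smul_zero]),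
    smul_zero]

/-! ## §3. The standing model hypotheses of the lineage hold in the `SU(N)` model -/

/-- **`hG1`: `|U| ≤ 1`** (operator norm) on `SU(N)`. [cite: Balaban1987RG1, pp.251–252] -/
theorem suModel_norm_le : ∀ g ∈ (suModel N).G, ‖(g : M[N])‖ ≤ 1 := by
  intro g hg
  rw [mem_suModel_G, Matrix.mem_specialUnitaryGroup_iff] at hg
  rcases subsingleton_or_nontrivial M[N] with h | h
  · rw [Subsingleton.elim (g : M[N]) 0, norm_zero]; exact zero_le_one
  · exact (CStarRing.norm_of_mem_unitary hg.1).le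

/-- **`hGc`: `SU(N) ≤ SL(N, ℂ)`**. [cite: Balaban1987RG1, p.252] -/
theorem suModel_G_le_Gc : (suModel N).G ≤ (suModel N).Gc := fun _ hu =>
  (Matrix.mem_specialUnitaryGroup_iff.1 hu).2

/-- **`hgc`: `𝔰𝔩(N, ℂ)` is `Ad(SU(N))`-stable** (indeed `Ad(GL(N, ℂ))`-stable: `tr(gXg⁻¹) = tr X`). [cite: Balaban1987RG1, (1.10) p.262] -/
theorem suModel_gc_conj :
    ∀ g ∈ (suModel N).G, ∀ X ∈ (suModel N).gc, (g : M[N]) * X * ((g⁻¹ : (M[N])ˣ) : M[N]) ∈ (suModel N).gc := by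
  intro g _ X hX
  rw [mem_suModel_gc] at hX ⊢
  rw [trace_units_conj, hX]

/-- **`hgcN` (step form): `𝔰𝔩(N, ℂ)` is closed under `newPot ξ` in its range**, `ξ ≥ 0`. [cite: Balaban1987RG1, (1.13) p.262] -/
theorem suModel_gc_newPot {ξ : ℝ} (hξ : 0 ≤ ξ) :
    ∀ X ∈ (suModel N).gc, ∀ Y ∈ (suModel N).gc, ξ * (‖X‖ + ‖Y‖) ≤ 1 / 4 → newPot ξ X Y ∈ (suModel N).gc := by
  intro X hX Y hY h
  rw [mem_suModel_gc] at hX hY ⊢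
  exact trace_newPot_eq_zero hξ h hX hY

/-- **`heGc`: `exp iξE(x) ∈ SL(N, ℂ)` for traceless `E`** (Liouville: `det e^{iξE} = e^{iξ tr E} = 1`). [cite: Balaban1987RG1, (1.10) p.262] -/
theorem suModel_expI_mem_Gc {S : Type*} (ξ : ℝ) {E : S → M[N]} (hE : ∀ x, (E x).trace = 0) :
    ∀ x, expI ξ (E x) ∈ (suModel N).Gc := by
  intro x
  rw [mem_suModel_Gc]
  show Matrix.det (exp ((I * (ξ : ℂ)) • E x)) = 1
  rw [det_exp, Matrix.trace_smul, hE x, smul_zero, Complex.exp_zero]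

/-- **`hgcE`: `𝔰𝔩(N, ℂ)` is `Ad(exp iξE)`-stable**. [cite: Balaban1987RG1, (1.10) p.262] -/
theorem suModel_gc_conjE {S : Type*} (ξ : ℝ) (E : S → M[N]) :
    ∀ x, ∀ X ∈ (suModel N).gc, (expI ξ (E x) : M[N]) * X * (((expI ξ (E x))⁻¹ : (M[N])ˣ) : M[N]) ∈ (suModel N).gc := by
  intro x X hX
  rw [mem_suModel_gc] at hX ⊢
  rw [trace_units_conj, hX]

/-- «`E` is `𝔤ᶜ`-valued» reads `tr E(x) = 0`. [cite: Balaban1987RG1, (1.13) p.262] -/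
theorem suModel_gcValued {S : Type*} {E : S → M[N]} (hE : ∀ x, (E x).trace = 0) : ∀ x, E x ∈ (suModel N).gc :=
  fun x => mem_suModel_gc.2 (hE x)

/-! ## §4. Hypothesis-free corollaries in the `SU(N)` model -/

variable {P : Params} {i : ℕ}

/-- **(i)–(iii) are invariant under `SU(N)`-valued gauge transformations** (same constants). [cite: Balaban1987RG1, (3.29) p.276] -/
theorem satisfiesI_III_act_iff_su {F : Frame P i M[N]} {c : StepConsts} {α₀ α₁ γ₀ : ℝ} (Φ : FieldPair P i (M[N])ˣ M[N])
    {v : Site P i → (M[N])ˣ} (hv : ∀ x, (v x : M[N]) ∈ Matrix.specialUnitaryGroup (Fin N) ℂ) :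
    SatisfiesI_III (suModel N) F c α₀ α₁ γ₀ (act v Φ) ↔ SatisfiesI_III (suModel N) F c α₀ α₁ γ₀ Φ :=
  satisfiesI_III_act_iff suModel_norm_le suModel_G_le_Gc suModel_gc_conj Φ hv

/-- **(3.16) is invariant under `SU(N)`-valued gauge transformations**. [cite: Balaban1987RG1, (3.16) p.273] -/
theorem act_mem_space316_iff_su {Fj : Frame P i M[N]} {cj : StepConsts} {Fk : Frame P i M[N]} {ck : StepConsts} {β α₀ α₁ : ℝ}
    (Φ : FieldPair P i (M[N])ˣ M[N]) {v : Site P i → (M[N])ˣ} (hv : ∀ x, (v x : M[N]) ∈ Matrix.specialUnitaryGroup (Fin N) ℂ) :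
    act v Φ ∈ space316 (suModel N) Fj cj Fk ck β α₀ α₁ ↔ Φ ∈ space316 (suModel N) Fj cj Fk ck β α₀ α₁ :=
  act_mem_space316_iff suModel_norm_le suModel_G_le_Gc suModel_gc_conj Φ hv

/-- **The near-`G` clause of (3.29), sharp constants, `SU(N)` model, hypothesis-free**: for `(𝐔, 𝐉)` satisfying (i)–(iii) with
`(α₀, α₁, γ₀)` on the whole lattice and `v = w·exp(iξE)` with `w` `SU(N)`-valued, `E` traceless, `|E| ≤ δ₀`, `|∇^ξ_𝐔E| ≤ δ₁`,
`ξ(α₁ + 2δ₀) ≤ 1/16`, the pair `(𝐔, 𝐉)^v` satisfies (i)–(iii) with any `α₀′ ≥ e^{2ξδ₀}α₀`, `γ₀′ ≥ e^{2ξδ₀}γ₀`,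
`α₁′ ≥ α₁ + (3 + 12α₁ + 3ξα₀)δ₀ + 4δ₁`. [cite: Balaban1987RG1, (3.29) p.276] -/
theorem satisfiesI_III_act_near_su {F : Frame P i M[N]} (hXb : ∀ b, b ∈ F.X.bonds) (hXp : ∀ p, p ∈ F.X.plaqs)
    {c : StepConsts} (hξ : 0 < c.ξ) (hcB : 0 ≤ c.cB) {α₀ α₁ γ₀ δ₀ δ₁ α₀' α₁' γ₀' : ℝ} (hα₀ : 0 ≤ α₀) (hα₁ : 0 ≤ α₁)
    (hδ₁ : 0 ≤ δ₁) (hs : c.ξ * (α₁ + 2 * δ₀) ≤ 1 / 16) (hα₀' : Real.exp (2 * (c.ξ * δ₀)) * α₀ ≤ α₀')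
    (hγ₀' : Real.exp (2 * (c.ξ * δ₀)) * γ₀ ≤ γ₀') (hα₁' : α₁ + (3 + 12 * α₁ + 3 * c.ξ * α₀) * δ₀ + 4 * δ₁ ≤ α₁')
    {Φ : FieldPair P i (M[N])ˣ M[N]} (h : SatisfiesI_III (suModel N) F c α₀ α₁ γ₀ Φ)
    {w : Site P i → (M[N])ˣ} (hw : ∀ x, (w x : M[N]) ∈ Matrix.specialUnitaryGroup (Fin N) ℂ) {E : Site P i → M[N]}
    (hE : ∀ x, (E x).trace = 0) (hE0 : ∀ x, ‖E x‖ ≤ δ₀) (hE1 : ∀ x μ, ‖nabla c.ξ Φ.U μ E x‖ ≤ δ₁) :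
    SatisfiesI_III (suModel N) F c α₀' α₁' γ₀' (act (w * fun x => expI c.ξ (E x)) Φ) :=
  satisfiesI_III_act_near_step suModel_norm_le suModel_G_le_Gc suModel_gc_conj (suModel_gc_newPot hξ.le) hXb hXp hξ hcB
    hα₀ hα₁ hδ₁ hs hα₀' hγ₀' hα₁' h hw (suModel_gcValued hE) (suModel_expI_mem_Gc c.ξ hE) (suModel_gc_conjE c.ξ E) hE0 hE1

/-- **«A sufficiently small neighborhood of G-valued transformations», `SU(N)` model, hypothesis-free**: for all `α₀′ > α₀`,
`α₁′ > α₁`, `γ₀′ > γ₀` (and `ξα₁ < 1/16`) there is `δ > 0` such that every `v = w·exp(iξE)` with `w` `SU(N)`-valued, `E` traceless,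
`|E| ≤ δ`, `|∇^ξ_𝐔E| ≤ δ` carries the pairs satisfying (i)–(iii) with `(α₀, α₁, γ₀)` into those with `(α₀′, α₁′, γ₀′)`.
[cite: Balaban1987RG1, (3.29) p.276] -/
theorem exists_neighbourhood_su {F : Frame P i M[N]} (hXb : ∀ b, b ∈ F.X.bonds) (hXp : ∀ p, p ∈ F.X.plaqs) {c : StepConsts}
    (hξ : 0 < c.ξ) (hcB : 0 ≤ c.cB) {α₀ α₁ γ₀ α₀' α₁' γ₀' : ℝ} (hα₀ : 0 ≤ α₀) (hα₁ : 0 ≤ α₁) (hγ₀ : 0 ≤ γ₀)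
    (hξα : c.ξ * α₁ < 1 / 16) (hα₀' : α₀ < α₀') (hα₁' : α₁ < α₁') (hγ₀' : γ₀ < γ₀') :
    ∃ δ : ℝ, 0 < δ ∧ ∀ {Φ : FieldPair P i (M[N])ˣ M[N]}, SatisfiesI_III (suModel N) F c α₀ α₁ γ₀ Φ →
      ∀ {w : Site P i → (M[N])ˣ}, (∀ x, (w x : M[N]) ∈ Matrix.specialUnitaryGroup (Fin N) ℂ) →
        ∀ {E : Site P i → M[N]}, (∀ x, (E x).trace = 0) → (∀ x, ‖E x‖ ≤ δ) → (∀ x μ, ‖nabla c.ξ Φ.U μ E x‖ ≤ δ) →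
          SatisfiesI_III (suModel N) F c α₀' α₁' γ₀' (act (w * fun x => expI c.ξ (E x)) Φ) := by
  obtain ⟨δ, hδ, hmain⟩ := exists_neighbourhood_step suModel_norm_le suModel_G_le_Gc suModel_gc_conj
    (suModel_gc_newPot hξ.le) hXb hXp hξ hcB hα₀ hα₁ hγ₀ hξα hα₀' hα₁' hγ₀' (𝓜 := suModel N) (F := F)
  exact ⟨δ, hδ, fun h w hw E hE hE0 hE1 =>
    hmain h hw (suModel_gcValued hE) (suModel_expI_mem_Gc c.ξ hE) (suModel_gc_conjE c.ξ E) hE0 hE1⟩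

/-- **(1.34) is invariant under `SU(N)`-valued gauge transformations** ([II] Lemma 2, the gauge clause for the space).
[cite: Balaban1988RG2Cluster, Lemma 2 p.11] -/
theorem act329_mem_space134_iff_su {F : Frame P i M[N]} {c : StepConsts} {β α₀ α₁ ε₁ g : ℝ}
    (Ψ : FieldPair P i (M[N])ˣ M[N] × (PBond P i → M[N])) {u : Site P i → (M[N])ˣ}
    (hu : ∀ x, (u x : M[N]) ∈ Matrix.specialUnitaryGroup (Fin N) ℂ) :
    act329 u Ψ ∈ space134 (suModel N) F c β α₀ α₁ ε₁ g ↔ Ψ ∈ space134 (suModel N) F c β α₀ α₁ ε₁ g :=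
  act329_mem_space134_iff suModel_norm_le suModel_G_le_Gc Ψ hu

end

end Literature.MathematicalPhysics.QuantumFieldTheory.Balaban1983to89.B12RegularSpaces111SpecialUnitary
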